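import Mathlib
import Summits.ValiantsHypothesis.ValiantsHypothesis.Theorems.ValuativeGCTValuativeFlipTernaryArcSpan
import Summits.ValiantsHypothesis.ValiantsHypothesis.Theorems.ValuativeGCTValuativeFlipSeedTransfer
import Literature.Computability.AlgebraicComplexity.DeterminantalConormalBoundProofs
import Literature.Computability.AlgebraicComplexity.OrbitCoordinateRing

/-!
# Determinantal ternary forms are Zariski dense: the coefficients of `det (A₀x + A₁y + A₂z)` are
# algebraically independent (Jacobian criterion at the cyclic pencil)

Crux `ValuativeGCT.ValuativeFlip` (stmt-ValiantsHypothesis-12624), wall-breaker axis D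
("det-orbit-closure multiplicity bounds for detCensus", seat k3 gen 1), third file of the chain
discharging row 3 of the few-row table, over `ValuativeGCTValuativeFlipTernaryArcSpan` (arc
spanning), `ValuativeGCTValuativeFlipSeedTransfer` (chain rule, degree drop under `∂`) and
`DeterminantalConormalBoundProofs` (Jacobi's formula `D det = tr (adj · D)`).

* `algebraicIndependent_of_jacobian_surjective` — the JACOBIAN CRITERION in surjective form
  (char. 0): if at one point `p` the differential of the polynomial map `G : K^τ → K^ι` is onto,
  the `G_e` are algebraically independent (a left inverse `L` of the Jacobian at `p` gives the
  polynomial matrix `C(L)·J` with determinant `1` at `p`, and a minimal relation gives a nonzero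
  kernel vector over the domain `K[τ]`, exactly as in the square form
  `algebraicIndependent_of_det_pderiv_ne_zero`).
* `pderiv_coeff_sumAlgEquiv`, `eval_coeff_sumAlgEquiv` — outer coefficients commute with inner
  derivatives / evaluations under `K[σ₁ ⊔ σ₂] ≅ K[σ₂][σ₁]` (`MvPolynomial.sumAlgEquiv`).
* `pderiv_det_genPencil`, `eval_pderiv_coeff_det_genPencil` — for the generic ternary pencil
  `genP = (Σ_t x_t a^{(t)}_{ij})`, `∂ det(genP)/∂a^{(t)}_{ij} = x_t · adj(genP)_{ji}` (Jacobi), so the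
  Jacobian of the coefficient map `A ↦ (coeff_e det(Σ_t A^{(t)} x_t))_e` at `A` has columns the
  coefficient vectors of `x_t · adj(M_A)_{ji}`.
* `algebraicIndependent_coeff_det_ternaryPencil` — at the cyclic pencil `M₀ = z·1 − X_w`,
  `wᵢ = x − i·y`, these columns span all ternary forms of degree `n + 1`
  (`monomial_mem_span_X_mul_adjugate_cyclicPencil`), so the coefficient polynomials are
  ALGEBRAICALLY INDEPENDENT: no nonzero polynomial in the coefficients of a ternary form of degree
  `m` vanishes on all determinantal forms — the density half of Dickson's theorem (1921) that the
  general ternary form of every degree is a linear determinant, with an elementary proof.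

References: L. E. Dickson, *Determination of all general homogeneous polynomials expressible as
determinants with linear elements*, Trans. AMS 22 (1921) 167–179; A. Beauville, *Determinantal
hypersurfaces*, Michigan Math. J. 48 (2000); R. Ehrenborg, G.-C. Rota, Europ. J. Combin. 14 (1993)
Thm 2.2 (Jacobian criterion) [folklore].
-/

-- `Summit.ValiantsHypothesis.ValiantsHypothesis.…` is the tree's mandated single-conjunct layout (Sub = Summit).
set_option linter.dupNamespace false

namespace Summit.ValiantsHypothesis.ValiantsHypothesis.Theorems.ValuativeFlip

open scoped BigOperators Matrix
open Finset
open Fin.CommRing  -- `Fin (n+1)` as a commutative ring (scoped Mathlib instance): cyclic index arithmetic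

noncomputable section

/-! ## The Jacobian criterion, surjective-differential form -/

section Jacobian

open MvPolynomial

variable {K : Type*} [Field K] {ι τ : Type*}

/-- **Jacobian criterion for algebraic independence, surjective form** (sufficient half,
characteristic zero).  If at some point `p` the differential of the polynomial map
`G = (G_e)_e : K^τ → K^ι` is onto — for every `e` some tangent vector `w ∈ K^τ` has
`dG_p(w) = (Σ_v w_v ∂_v G_{e'} (p))_{e'}` equal to the `e`-th basis vector — then the `G_e` are
algebraically independent over `K`.  Proof: the tangent vectors assemble into a matrix `L` with
`L · J(p) = 1` for the Jacobian `J = (∂_v G_{e'})`; the polynomial matrix `𝒥 = C(L) · J` has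
`det 𝒥 (p) = 1`, so `det 𝒥 ≠ 0`, and a relation `P(G) = 0` of minimal degree would give, by the chain
rule (`pderiv_aeval_eq_sum`), the nonzero kernel vector `((∂_e P)(G))_e` of `𝒥` over the domain
`K[τ]` — exactly as in the square form `algebraicIndependent_of_det_pderiv_ne_zero`. [folklore] -/
theorem algebraicIndependent_of_jacobian_surjective [CharZero K] [Fintype ι] [Fintype τ]
    [DecidableEq ι] [DecidableEq τ] (G : ι → MvPolynomial τ K) (p : τ → K)
    (hsurj : ∀ e : ι, ∃ w : τ → K, ∀ e' : ι,
      ∑ v, w v * eval p (pderiv v (G e')) = if e' = e then 1 else 0) :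
    AlgebraicIndependent K G := by
  classical
  choose L hL using hsurj
  -- the polynomial matrix `𝒥 = C(L) · J`, with `𝒥(p) = 1`
  set J : Matrix ι ι (MvPolynomial τ K) := Matrix.of fun e e' => ∑ v, C (L e v) * pderiv v (G e')
    with hJ
  have hJp : (eval p).mapMatrix J = 1 := by
    ext e e'
    rw [RingHom.mapMatrix_apply, Matrix.map_apply, hJ, Matrix.of_apply, map_sum, Matrix.one_apply]
    simp only [map_mul, eval_C]
    rw [hL e e']
    exact if_congr eq_comm rfl rfl
  have hdet : J.det ≠ 0 := by
    intro h0
    have := RingHom.map_det (eval p) J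
    rw [hJp, Matrix.det_one, h0, map_zero] at this
    exact zero_ne_one this
  rw [algebraicIndependent_iff]
  by_contra hcon
  push Not at hcon
  have hex : ∃ d : ℕ, ∃ P : MvPolynomial ι K, aeval G P = 0 ∧ P ≠ 0 ∧ P.totalDegree = d := by
    obtain ⟨P, hP, hP0⟩ := hcon
    exact ⟨_, P, hP, hP0, rfl⟩
  obtain ⟨P, hPG, hP0, hPd⟩ := Nat.find_spec hex
  have hmin : ∀ Q : MvPolynomial ι K, aeval G Q = 0 → Q ≠ 0 → P.totalDegree ≤ Q.totalDegree :=
    fun Q h1 h2 => hPd ▸ Nat.find_min' hex ⟨Q, h1, h2, rfl⟩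
  -- some partial derivative of `P` is nonzero
  have hnc : ∃ i, pderiv i P ≠ 0 := by
    by_contra hall
    push Not at hall
    have hPC := eq_C_of_forall_pderiv_eq_zero P hall
    rw [hPC, aeval_C, algebraMap_eq, C_eq_zero] at hPG
    rw [hPC, hPG, C_0] at hP0
    exact hP0 rfl
  -- the kernel vector
  set w : ι → MvPolynomial τ K := fun i => aeval G (pderiv i P) with hw
  have hwne : w ≠ 0 := by
    obtain ⟨i, hi⟩ := hnc
    intro hw0
    have hwi : aeval G (pderiv i P) = 0 := congrFun hw0 i
    exact absurd (hmin _ hwi hi) (not_le.mpr (totalDegree_pderiv_lt i hi))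
  have hMv : J *ᵥ w = 0 := by
    funext e
    rw [Matrix.mulVec, Pi.zero_apply]
    change ∑ e', (∑ v, C (L e v) * pderiv v (G e')) * aeval G (pderiv e' P) = 0
    simp_rw [Finset.sum_mul]
    rw [Finset.sum_comm]
    refine Finset.sum_eq_zero fun v _ => ?_
    have h := pderiv_aeval_eq_sum G P v
    rw [hPG, map_zero] at h
    calc ∑ e', C (L e v) * pderiv v (G e') * aeval G (pderiv e' P)
        = C (L e v) * ∑ e', aeval G (pderiv e' P) * pderiv v (G e') := by
          rw [Finset.mul_sum]
          exact Finset.sum_congr rfl fun e' _ => by ring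
      _ = 0 := by rw [← h, mul_zero]
  exact hwne (Matrix.eq_zero_of_mulVec_eq_zero hdet hMv)

end Jacobian

/-! ## Coefficients in the outer variables commute with derivatives and evaluations in the inner
variables (`MvPolynomial.sumAlgEquiv`) -/

section SumCoeff

open MvPolynomial

variable {K : Type*} [CommRing K] {σ₁ σ₂ : Type*}

/-- `∂_v` (inner variable) commutes with taking the coefficient of an outer monomial:
`∂_v (coeff_e F) = coeff_e (∂_{inr v} F)` under `K[σ₁ ⊔ σ₂] ≅ K[σ₂][σ₁]`. [folklore] -/
theorem pderiv_coeff_sumAlgEquiv [DecidableEq σ₁] [DecidableEq σ₂] (v : σ₂)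
    (F : MvPolynomial (σ₁ ⊕ σ₂) K) (e : σ₁ →₀ ℕ) :
    pderiv v (coeff e (sumAlgEquiv K σ₁ σ₂ F)) =
      coeff e (sumAlgEquiv K σ₁ σ₂ (pderiv (Sum.inr v) F)) := by
  induction F using MvPolynomial.induction_on generalizing e with
  | C a =>
    rw [sumAlgEquiv_C_inl, pderiv_C, map_zero, coeff_zero, coeff_C]
    split_ifs <;> simp
  | add p q hp hq =>
    simp only [map_add, coeff_add, hp, hq]
  | mul_X p s hp =>
    rcases s with t | v'
    · rw [map_mul, sumAlgEquiv_X_inl, coeff_mul_X', Derivation.leibniz, pderiv_X,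
        Pi.single_eq_of_ne Sum.inl_ne_inr, smul_zero, zero_add, smul_eq_mul, map_mul,
        sumAlgEquiv_X_inl, mul_comm, coeff_mul_X']
      split_ifs with h
      · exact hp _
      · exact map_zero _
    · rw [map_mul, sumAlgEquiv_X_inr, mul_comm, coeff_C_mul, Derivation.leibniz, Derivation.leibniz,
        pderiv_X, pderiv_X, smul_eq_mul, smul_eq_mul, smul_eq_mul, smul_eq_mul, map_add, map_mul,
        map_mul, sumAlgEquiv_X_inr, coeff_add, hp, coeff_C_mul]
      by_cases hv : v' = v
      · subst hv
        rw [Pi.single_eq_same, Pi.single_eq_same, map_one, mul_one, mul_one]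
        ring
      · rw [Pi.single_eq_of_ne hv, Pi.single_eq_of_ne (fun h => hv (Sum.inr_injective h)), map_zero,
          mul_zero, mul_zero, coeff_zero, zero_add, add_zero]

/-- Evaluating the inner variables at a point commutes with outer coefficients:
`(coeff_e F)(p) = coeff_e (F|_{inner := p})`. [folklore] -/
theorem eval_coeff_sumAlgEquiv (p : σ₂ → K) (F : MvPolynomial (σ₁ ⊕ σ₂) K) (e : σ₁ →₀ ℕ) :
    eval p (coeff e (sumAlgEquiv K σ₁ σ₂ F)) =
      coeff e ((aeval (Sum.elim X fun v => C (p v)) :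
        MvPolynomial (σ₁ ⊕ σ₂) K →ₐ[K] MvPolynomial σ₁ K) F) := by
  have h : ((MvPolynomial.map (eval p)).comp (sumAlgEquiv K σ₁ σ₂).toAlgHom.toRingHom :
      MvPolynomial (σ₁ ⊕ σ₂) K →+* MvPolynomial σ₁ K) =
      ((aeval (Sum.elim X fun v => C (p v)) :
        MvPolynomial (σ₁ ⊕ σ₂) K →ₐ[K] MvPolynomial σ₁ K)).toRingHom := by
    refine ringHom_ext (fun a => ?_) (fun s => ?_)
    · simp [sumAlgEquiv_C_inl]
    · rcases s with t | v
      · simp [sumAlgEquiv_X_inl]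
      · simp [sumAlgEquiv_X_inr]
  have := congrArg (fun f => coeff e (f F)) h
  rw [RingHom.coe_comp, Function.comp_apply, coeff_map] at this
  exact this

end SumCoeff

/-! ## The generic ternary pencil: its determinant's coefficients are algebraically independent -/

section Pencil

open MvPolynomial
open Literature.Computability.AlgebraicComplexity

variable {K : Type*} [Field K] {n : ℕ}

/-- `genP⟦K, n⟧`: the generic ternary pencil `(Σ_t x_t · a^{(t)}_{ij})_{ij}` of `(n+1) × (n+1)`
matrices, over `K[x₀, x₁, x₂ ; a^{(t)}_{ij}]`. -/
local notation3 (prettyPrint := false) "genP⟦" K ", " n "⟧" =>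
  (Matrix.of fun i j : Fin (n + 1) => ∑ t : Fin 3,
    (MvPolynomial.X (Sum.inl t) : MvPolynomial (Fin 3 ⊕ (Fin 3 × Fin (n + 1) × Fin (n + 1))) K) *
      MvPolynomial.X (Sum.inr (t, i, j)))

/-- Specialising the coefficients of the generic pencil at `A : Fin 3 × _ × _ → K` gives the pencil
`(Σ_t A^{(t)}_{ij} x_t)_{ij}` of ternary linear forms. [folklore] -/
theorem genPencil_map_aeval (A : Fin 3 × Fin (n + 1) × Fin (n + 1) → K) :
    (genP⟦K, n⟧).map ((aeval (Sum.elim X fun v => C (A v)) :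
        MvPolynomial (Fin 3 ⊕ (Fin 3 × Fin (n + 1) × Fin (n + 1))) K →ₐ[K] MvPolynomial (Fin 3) K)) =
      Matrix.of fun i j : Fin (n + 1) => ∑ t : Fin 3, (X t : MvPolynomial (Fin 3) K) * C (A (t, i, j)) := by
  refine Matrix.ext fun i j => ?_
  simp [Matrix.map_apply, Matrix.of_apply, map_sum, map_mul]

/-- **Evaluation of the coefficient polynomials.**  At the point `A`, the polynomial
`coeff_e (det genP)` takes the value `coeff_e det (Σ_t A^{(t)} x_t)`. [folklore] -/
theorem eval_coeff_det_genPencil (A : Fin 3 × Fin (n + 1) × Fin (n + 1) → K) (e : Fin 3 →₀ ℕ) :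
    eval A (coeff e (sumAlgEquiv K (Fin 3) (Fin 3 × Fin (n + 1) × Fin (n + 1)) (genP⟦K, n⟧).det)) =
      coeff e (Matrix.of fun i j : Fin (n + 1) =>
        ∑ t : Fin 3, (X t : MvPolynomial (Fin 3) K) * C (A (t, i, j))).det := by
  rw [eval_coeff_sumAlgEquiv, AlgHom.map_det, ← genPencil_map_aeval A]
  rfl

/-- **Jacobi's formula for the generic pencil.**  `∂/∂a^{(t)}_{ij} det (genP) = x_t · adj(genP)_{ji}`.
[folklore] -/
theorem pderiv_det_genPencil (t : Fin 3) (i j : Fin (n + 1)) :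
    pderiv (Sum.inr (t, i, j)) (genP⟦K, n⟧).det =
      (X (Sum.inl t) : MvPolynomial (Fin 3 ⊕ (Fin 3 × Fin (n + 1) × Fin (n + 1))) K) *
        (genP⟦K, n⟧).adjugate j i := by
  classical
  rw [DeterminantalConormal.derivation_det_eq_trace_adjugate_mul]
  have hD : (genP⟦K, n⟧).map (pderiv (Sum.inr (t, i, j)) :
      MvPolynomial (Fin 3 ⊕ (Fin 3 × Fin (n + 1) × Fin (n + 1))) K →
        MvPolynomial (Fin 3 ⊕ (Fin 3 × Fin (n + 1) × Fin (n + 1))) K) =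
      Matrix.of fun i' j' : Fin (n + 1) => if i' = i ∧ j' = j then
        (X (Sum.inl t) : MvPolynomial (Fin 3 ⊕ (Fin 3 × Fin (n + 1) × Fin (n + 1))) K) else 0 := by
    refine Matrix.ext fun i' j' => ?_
    simp only [Matrix.map_apply, Matrix.of_apply, map_sum, Derivation.leibniz, pderiv_X,
      smul_eq_mul]
    simp only [Pi.single_apply, Sum.inr.injEq, Prod.mk.injEq, reduceCtorEq, if_false, mul_zero,
      add_zero]
    by_cases h : i' = i ∧ j' = j
    · obtain ⟨rfl, rfl⟩ := h
      simp
    · rw [if_neg h]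
      refine Finset.sum_eq_zero fun t' _ => ?_
      rw [if_neg, mul_zero]
      tauto
  rw [hD, Matrix.trace]
  simp only [Matrix.diag_apply, Matrix.mul_apply, Matrix.of_apply, mul_ite, mul_zero]
  rw [Finset.sum_eq_single j]
  · rw [Finset.sum_eq_single i]
    · simp [mul_comm]
    · intro b _ hb
      rw [if_neg]
      exact fun h => hb h.1
    · intro h; exact absurd (Finset.mem_univ i) h
  · intro a _ ha
    refine Finset.sum_eq_zero fun b _ => ?_
    rw [if_neg]
    exact fun h => ha h.2
  · intro h; exact absurd (Finset.mem_univ j) h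

/-- **The Jacobian of the coefficient map at a point.**  For the coefficient polynomials
`G_e = coeff_e det (genP)` and any point `A`,
`(∂ G_e / ∂ a^{(t)}_{ij})(A) = coeff_e (x_t · adj(M_A)_{ji})`, `M_A = Σ_t A^{(t)} x_t`. [folklore] -/
theorem eval_pderiv_coeff_det_genPencil (A : Fin 3 × Fin (n + 1) × Fin (n + 1) → K)
    (v : Fin 3 × Fin (n + 1) × Fin (n + 1)) (e : Fin 3 →₀ ℕ) :
    eval A (pderiv v (coeff e
      (sumAlgEquiv K (Fin 3) (Fin 3 × Fin (n + 1) × Fin (n + 1)) (genP⟦K, n⟧).det))) =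
      coeff e ((X v.1 : MvPolynomial (Fin 3) K) * (Matrix.of fun i j : Fin (n + 1) =>
        ∑ t : Fin 3, (X t : MvPolynomial (Fin 3) K) * C (A (t, i, j))).adjugate v.2.2 v.2.1) := by
  classical
  obtain ⟨t, i, j⟩ := v
  rw [pderiv_coeff_sumAlgEquiv, eval_coeff_sumAlgEquiv, pderiv_det_genPencil, map_mul, aeval_X,
    Sum.elim_inl, ← genPencil_map_aeval A]
  congr 2
  have h := RingHom.map_adjugate ((aeval (Sum.elim X fun v => C (A v)) :
    MvPolynomial (Fin 3 ⊕ (Fin 3 × Fin (n + 1) × Fin (n + 1))) K →ₐ[K] MvPolynomial (Fin 3) K)).toRingHom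
    (genP⟦K, n⟧)
  have h' := congrFun (congrFun h j) i
  rw [RingHom.mapMatrix_apply, Matrix.map_apply] at h'
  exact h'

/-- **Zariski density of determinantal ternary forms (Dickson), as algebraic independence.**  Over a
field of characteristic zero, the coefficient polynomials `coeff_e det (Σ_t x_t A^{(t)})`,
`e` ranging over the ternary monomials of degree `n + 1`, are ALGEBRAICALLY INDEPENDENT polynomials
in the `3(n+1)²` matrix entries: no nonzero polynomial in the coefficients of a ternary form of
degree `m` vanishes on all determinantal forms `det (A₀ x + A₁ y + A₂ z)`, `Aₜ ∈ K^{m × m}`.  Proof: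
the Jacobian criterion at the cyclic pencil `M₀ = z·1 − X_w`, `wᵢ = x − i·y`, where the differential
`(Bₜ) ↦ Σ x_t tr (adj M₀ · Bₜ)` is onto (`monomial_mem_span_X_mul_adjugate_cyclicPencil`).  This is
the density half of Dickson's theorem that the general ternary form of every degree is a linear
determinant. [cite: Dickson1921, Thm. p. 176 (density half); proof folklore (Jacobian criterion)] -/
theorem algebraicIndependent_coeff_det_ternaryPencil {K : Type*} [Field K] [CharZero K] (n : ℕ) :
    AlgebraicIndependent K fun e : DegIdx (Fin 3) (n + 1) => MvPolynomial.coeff e.1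
      (MvPolynomial.sumAlgEquiv K (Fin 3) (Fin 3 × Fin (n + 1) × Fin (n + 1))
        (Matrix.det (Matrix.of fun i j : Fin (n + 1) => ∑ t : Fin 3,
          (MvPolynomial.X (Sum.inl t) : MvPolynomial (Fin 3 ⊕ (Fin 3 × Fin (n + 1) × Fin (n + 1))) K) *
            MvPolynomial.X (Sum.inr (t, i, j))))) := by
  classical
  -- the base point: the cyclic pencil `M₀ = z·1 − X_w`, `wᵢ = x − i·y`
  set η : Fin (n + 1) → K := fun i => (i : ℕ) with hη'
  have hη : Function.Injective η := fun i j h => Fin.ext (Nat.cast_injective (R := K) h)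
  set A : Fin 3 × Fin (n + 1) × Fin (n + 1) → K := fun v =>
    ![if v.2.2 = v.2.1 + 1 then -1 else 0, if v.2.2 = v.2.1 + 1 then η v.2.1 else 0,
      if v.2.1 = v.2.2 then 1 else 0] v.1 with hA
  have hMA : (Matrix.of fun i j : Fin (n + 1) =>
      ∑ t : Fin 3, (X t : MvPolynomial (Fin 3) K) * C (A (t, i, j))) =
      (X 2 : MvPolynomial (Fin 3) K) • (1 : Matrix (Fin (n + 1)) (Fin (n + 1)) (MvPolynomial (Fin 3) K)) -
        Matrix.of fun i j : Fin (n + 1) => if j = i + 1 then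
          (X 0 - C (η i) * X 1 : MvPolynomial (Fin 3) K) else 0 := by
    refine Matrix.ext fun i j => ?_
    simp only [Matrix.of_apply, Fin.sum_univ_three, hA, Matrix.cons_val_zero, Matrix.cons_val_one,
      Matrix.head_cons, Matrix.cons_val_two, Matrix.tail_cons, Matrix.sub_apply, Matrix.smul_apply,
      Matrix.one_apply, smul_eq_mul, mul_ite, mul_one, mul_zero]
    split_ifs <;> simp only [map_neg, map_one, map_zero, mul_neg, mul_one, mul_zero] <;> ring
  refine algebraicIndependent_of_jacobian_surjective _ A fun e => ?_
  obtain ⟨c, hc⟩ := (Submodule.mem_span_range_iff_exists_fun K).mp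
    (monomial_mem_span_X_mul_adjugate_cyclicPencil η hη e.1 ((mem_degMonomials_iff).mp e.2))
  refine ⟨c, fun e' => ?_⟩
  simp only [eval_pderiv_coeff_det_genPencil, hMA]
  have := congrArg (coeff e'.1) hc
  rw [coeff_sum, coeff_monomial] at this
  simp only [coeff_smul, smul_eq_mul] at this
  rw [this]
  by_cases h : e' = e
  · subst h; simp
  · rw [if_neg h, if_neg]
    exact fun h' => h (Subtype.ext h'.symm)

end Pencil

end

end Summit.ValiantsHypothesis.ValiantsHypothesis.Theorems.ValuativeFlip
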